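import Literature.Geometry.Riemannian.GradientSolitonIdentities
import Literature.Geometry.Lorentzian.CoordPinchingMinimum
import Literature.Geometry.Lorentzian.CoordRicciEigenframe
import HarnessLib

/-!
# A pinching minimum of the bottom Ricci eigenvalue on a three-dimensional shrinker with `sect ≥ 0`

The point computation of step 1 of Munteanu–Wang's theorem "positively curved shrinking Ricci
solitons are compact" (O. Munteanu, J. Wang, J. Differential Geom. 106 (2017), Thm. 2; B. Chow,
*Ricci solitons in low dimensions* (2023), Thm. 4.47): on a gradient shrinking soliton with
`sect ≥ 0` the bottom eigenvalue `λ` of `Ric` satisfies `Δ_f λ ≤ λ` in the barrier sense, because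
in `Δ_f Ric = Ric − 2 Rm(Ric)` the term `Rm(Ric)(v,v) = Σ K(v,e_l) λ_l` is `≥ 0`. In the
coordinate language (`MetricCoord`, metric components `G` on an open `V` of a `3`-dimensional
model space, soliton `Ric + Hess f = ½ G`), at a point `x ∈ V` with a `G_x`-orthonormal
eigenframe `e` of `Ric_x` (eigenvalues `μ`, `e₀` a BOTTOM eigenvector), `0 ≤ μ₀` and the
sectional inequalities `2μᵢ ≤ μ₀ + μ₁ + μ₂` at `x`, and a smooth `Ψ` with the pinching
`Ψ(y) G_y(w,w) ≤ Ric_y(w,w)` on `V` and equality at `(x, e₀)`: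

* **`IsMetricOn.weightedLaplacian_le_at_ricci_pinching_minimum`** —
  `ΔΨ(x) − dΨ_x(♯df_x) ≤ μ₀`, i.e. `Δ_f Ψ (x) ≤ λ(x)`.

Proof: `IsMetricOn.pinching_minimum_laplacian` (with `m = 1`, `φ = Ψ`) gives
`ΔΨ ≤ (ΔRic)(e₀,e₀)` and `(∇_X Ric)(e₀,e₀) = dΨ(X)`; Hamilton's identity on the eigenvector
(`lapBilinAt_ricAt_self_of_soliton_eigenframe`) turns `(ΔRic)(e₀,e₀) − (∇_{♯df}Ric)(e₀,e₀)` into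
`μ₀ − [μ₁(μ₀+μ₁−μ₂) + μ₂(μ₀+μ₂−μ₁)]`, and the bracket is `≥ 0`. Everything is proved; no
definition is introduced.

## References

* O. Munteanu, J. Wang, *Positively curved shrinking Ricci solitons are compact*,
  J. Differential Geom. 106 (2017) = arXiv:1504.07898, Thm. 2, proof, (2.3)–(2.5). [MunteanuWang2017]
* M. Eminenti, G. La Nave, C. Mantegazza, manuscripta math. 127 (2008), §3 (p. 7). [EminentiLanaveMantegazza2008]
-/

noncomputable section

set_option maxSynthPendingDepth 3

open Set Filter Module
open scoped Topology ContDiff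

namespace Literature.Geometry.Lorentzian

namespace MetricCoord

variable {E : Type*} [NormedAddCommGroup E] [NormedSpace ℝ E] [FiniteDimensional ℝ E]
  [CompleteSpace E] {G : E → E →L[ℝ] E →L[ℝ] ℝ} {V : Set E} {x : E} {f : E → ℝ}

/-- **`Δ_f Ψ ≤ λ` at a pinching minimum of the bottom Ricci eigenvalue, `sect ≥ 0`** (see the
module docstring): `lapAt G Ψ x − dΨ_x(♯df_x) ≤ μ₀`.
[cite: MunteanuWang2017, Thm. 2, proof, (2.3)–(2.5)] [cite: EminentiLanaveMantegazza2008, §3 (p. 7)] -/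
theorem IsMetricOn.weightedLaplacian_le_at_ricci_pinching_minimum (hG : IsMetricOn G V)
    (hx : x ∈ V) (hpos : ∀ w : E, w ≠ 0 → 0 < G x w w) (hf : ContDiffOn ℝ ∞ f V)
    (hsol : ∀ y ∈ V, ∀ v w, ricAt G y v w + hessAt G f y v w = (1 / 2 : ℝ) * G y v w)
    (e : Basis (Fin 3) ℝ E) (he : ∀ i j, G x (e i) (e j) = if i = j then 1 else 0)
    {μ : Fin 3 → ℝ} (hμ : ∀ i w, ricAt G x (e i) w = μ i * G x (e i) w)
    (hbot : ∀ i, μ 0 ≤ μ i) (hμ0 : 0 ≤ μ 0) (hsect : ∀ i, 2 * μ i ≤ μ 0 + μ 1 + μ 2)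
    {Ψ : E → ℝ} (hΨ : ContDiffOn ℝ ∞ Ψ V)
    (hpin : ∀ y ∈ V, ∀ w, Ψ y * G y w w ≤ ricAt G y w w)
    (heq : ricAt G x (e 0) (e 0) = Ψ x * G x (e 0) (e 0)) :
    lapAt G Ψ x - fderiv ℝ Ψ x (sharpAt G x (fderiv ℝ f x)) ≤ μ 0 := by
  have he00 : G x (e 0) (e 0) = 1 := by rw [he]; simp
  -- the pinching minimum, `m = 1`, `φ = Ψ`
  have hmin : ∀ y ∈ V, ∀ w, (1 : ℝ) * Ψ y * G y w w ≤ ricAt G y w w := fun y hy w ↦ by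
    rw [one_mul]; exact hpin y hy w
  have heq' : ricAt G x (e 0) (e 0) = (1 : ℝ) * Ψ x * G x (e 0) (e 0) := by
    rw [one_mul]; exact heq
  obtain ⟨hfirst, hsecond⟩ := hG.pinching_minimum_laplacian hx hpos hG.contDiffOn_ricAt hΨ
    hmin heq'
  -- Hamilton's identity on the bottom eigenvector
  have hlapR := hG.lapBilinAt_ricAt_self_of_soliton_eigenframe e he hμ hx hf hsol
  have hX := hfirst (sharpAt G x (fderiv ℝ f x))
  rw [he00, mul_one, one_mul] at hX hsecond
  -- the curvature bracket is nonnegative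
  have hbr : 0 ≤ μ 1 * (μ 0 + μ 1 - μ 2) + μ 2 * (μ 0 + μ 2 - μ 1) := by
    have h1 : 0 ≤ μ 1 := hμ0.trans (hbot 1)
    have h2 : 0 ≤ μ 2 := hμ0.trans (hbot 2)
    have h3 : 0 ≤ μ 0 + μ 1 - μ 2 := by linarith [hsect 2]
    have h4 : 0 ≤ μ 0 + μ 2 - μ 1 := by linarith [hsect 1]
    exact add_nonneg (mul_nonneg h1 h3) (mul_nonneg h2 h4)
  rw [hX] at hlapR
  linarith

end MetricCoord

end Literature.Geometry.Lorentzian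

end
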